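import Summits.QuantumFields.YangMills.Theses.MirrorModularBoosts

/-!
# `MirrorModularBoosts.KernelBoundEngineGlue` — gluing the split engine

Route `MirrorModularBoosts` (sub-problem `YangMills`) splits its modular engine
`CurvatureBoostCovariance` (crux (B): eight planar mirrors + planar spectral cone ⇒ invariance of
the curvature channel `S₁` on `⁰𝒮` under every determinant-one isometry fixing `e₂`, `e₃`) into

* `CurvatureKernelBound` — the typed UV datum: the two-point function of `S₁` on `⁰𝒮` is a real
  kernel `K (x₀ - x₁)`, continuous off `0`, with `|K x| ≤ C * (1 + ‖x‖ ^ (η - 10))`, `η > 0`;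
* `SoftKernelBoostCovariance` — the engine below dimension five: the statement of
  `CurvatureBoostCovariance` with the conclusion of `CurvatureKernelBound` inserted verbatim as one
  extra antecedent.

The support item `KernelBoundEngineGlue` (stmt-QuantumFields-15000) records that the split is
exhaustive: `CurvatureKernelBound → SoftKernelBoostCovariance → CurvatureBoostCovariance`.
This file proves it. The proof is pure logic: for fixed `G`, `r`, `sch`, `S₁` carrying the
curvature-channel package `W₁`, the kernel bound supplies exactly the extra hypothesis the soft
engine consumes; the three route decls share the same binder prefix verbatim, so the terms match
definitionally (the `letI`/`let W₁` binders unfold by `ζ`-reduction).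

Sources: route-internal bookkeeping (planner sketch `kernelBoundEngineGlue_provable`);
Osterwalder–Schrader axioms as formalised in `Literature.MathematicalPhysics.AQFT`.
Deliberately NOT here: any of the three cruxes themselves (open items 11687, 14999, 9663).
-/

namespace Summit.QuantumFields.YangMills.Theorems

/-- **`KernelBoundEngineGlue` holds** (support item stmt-QuantumFields-15000 of route
`MirrorModularBoosts`): if every curvature channel `S₁` carrying the package `W₁` has a soft real
two-point kernel (`CurvatureKernelBound`), and the modular engine holds for every such `S₁` with
the eight planar reflection positivities, the planar spectral cone AND a soft kernel
(`SoftKernelBoostCovariance`), then the engine holds outright (`CurvatureBoostCovariance`).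
Proof: instantiate both hypotheses at the same `G`, `r`, `sch`, `S₁`, `W₁ r sch S₁` and feed the
kernel triple produced by the first into the extra slot of the second. [folklore] -/
theorem kernelBoundEngineGlue_proof :
    Summit.QuantumFields.YangMills.Theses.MirrorModularBoosts.KernelBoundEngineGlue := by
  unfold Summit.QuantumFields.YangMills.Theses.MirrorModularBoosts.KernelBoundEngineGlue
  intro hKB hSoft G _ _ _ _ hG W₁ r sch S₁ hW₁ h8 hcone
  exact hSoft G hG r sch S₁ hW₁ h8 hcone (hKB G hG r sch S₁ hW₁)

end Summit.QuantumFields.YangMills.Theorems
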